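import Literature.Geometry.ComplexAnalytic.PhamBrieskornJoinRankBase
import HarnessLib

/-!
# Milnor's theorem 9.1 (Betti number): the middle homology of the Milnor fibre of `z₀^{a₀} + ⋯ + zₙ₊₁^{aₙ₊₁}` has
# rank `Π (aᵢ − 1)` (Milnor 1968, Thm. 9.1; Pham 1965)

Milnor, *Singular points of complex hypersurfaces* (1968), **Theorem 9.1** (Pham, Brieskorn): for
`f(z₁, …, z_m) = z₁^{a₁} + ⋯ + z_m^{a_m}`, "the middle Betti number of the fiber `F` is
`(a₁ − 1)(a₂ − 1)⋯(a_m − 1)`" — the rank of `H̃_{m−1}(J) = H̃₀Ω_{a₁} ⊗ ⋯ ⊗ H̃₀Ω_{a_m}` for the join `J ⊂ F` onto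
which the fibre deformation retracts (Lemma 9.2). This file assembles the induction on the number of factors
from the tree's two-factor base (`PhamBrieskornJoinRankBase.finrank_singularHomology_join_two`) and recursion
(`PhamBrieskornJoinRankStep.finrank_singularHomology_join_succ`), for `m = n + 2 ≥ 2` factors and complex
coefficients:

* `PhamBrieskorn.finite_and_finrank_singularHomology_join` / `finrank_singularHomology_join` —
  **`dim_ℂ Hₙ₊₁(Ω_{a₀} * ⋯ * Ω_{aₙ₊₁}; ℂ) = Π_{i} (aᵢ − 1)`** (all `aᵢ ≠ 0`), with finite-dimensionality;
* `PhamBrieskorn.finrank_singularHomology_fibre` — **`dim_ℂ Hₙ₊₁(F; ℂ) = Π_{i} (aᵢ − 1)`** for the affine Milnor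
  fibre `F = {Σ zᵢ^{aᵢ} = 1} ⊂ ℂⁿ⁺²` (the Milnor number `μ` of the Pham–Brieskorn singularity), with
  `finite_singularHomology_fibre`.

The one-variable case (`m = 1`, `H̃₀(Ω_a)` of rank `a − 1`) is the statement `finrank_ker_ε` of the base file.
Everything is proved; no definition, no named fact. Consumer: the local model `μ(z₀² + z₁² + z₂^p) = p − 1` of
programme I2 (crux K1 of `Summits/HodgeConjecture/HodgeConjecture/Theses/CyclicUnitaryPowers.lean`), and the Fermat /
Pham–Brieskorn files of `Literature/AlgebraicGeometry/HodgeTheory`.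

## References

* [Milnor1968] J. Milnor, Singular Points of Complex Hypersurfaces, Ann. of Math. Studies 61 (1968), §9,
  Thm. 9.1, Lemma 9.2 and p. 77.
* [Pham1965] F. Pham, Formules de Picard–Lefschetz généralisées et ramification des intégrales, Bull. Soc. Math.
  France 93 (1965) 333–367, §1.
-/

noncomputable section

open Complex ContinuousMap Set Filter CategoryTheory Limits
open Literature.AlgebraicTopology.SingularHomology
open scoped unitInterval Topology

namespace Literature.Geometry.ComplexAnalytic

namespace PhamBrieskorn

/-- **Milnor's Theorem 9.1 (Betti number) for the join**: for `n + 2 ≥ 2` factors with all `aᵢ ≠ 0`,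
`Hₙ₊₁(Ω_{a₀} * ⋯ * Ω_{aₙ₊₁}; ℂ)` is finite-dimensional of dimension `Π_i (aᵢ − 1)` (induction on the number of
factors: two-factor base, Mayer–Vietoris recursion). [cite: Milnor1968, §9 Thm. 9.1 and p. 77] -/
theorem finite_and_finrank_singularHomology_join :
    ∀ (n : ℕ) (a : Fin (n + 2) → ℕ) (_ : ∀ i, a i ≠ 0),
      Module.Finite ℂ (singularHomology ℂ ℂ (join a) (n + 1)) ∧
        Module.finrank ℂ (singularHomology ℂ ℂ (join a) (n + 1)) = ∏ i, (a i - 1) := by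
  intro n
  induction n with
  | zero =>
    intro a ha
    classical
    haveI : Fintype (Omega (a (Fin.last (0 + 1)))) := (finite_Omega (ha _)).fintype
    refine ⟨finite_singularHomology_join_two ha, ?_⟩
    rw [finrank_singularHomology_join_two ha, card_Omega (ha _), Fin.prod_univ_two, mul_comm]
    rfl
  | succ n ih =>
    intro a ha
    classical
    haveI : Fintype (Omega (a (Fin.last (n + 1 + 1)))) := (finite_Omega (ha _)).fintype
    obtain ⟨hfin, hrank⟩ := ih (Fin.init a) (init_ne_zero ha)
    haveI := hfin
    refine ⟨finite_singularHomology_join_succ ha (Nat.succ_ne_zero n), ?_⟩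
    rw [finrank_singularHomology_join_succ ha (Nat.succ_ne_zero n), card_Omega (ha _), hrank,
      Fin.prod_univ_castSucc (fun i => a i - 1), mul_comm]
    rfl

/-- `Hₙ₊₁` of the join is finite-dimensional. [cite: Milnor1968, §9 Thm. 9.1] -/
theorem finite_singularHomology_join {n : ℕ} {a : Fin (n + 2) → ℕ} (ha : ∀ i, a i ≠ 0) :
    Module.Finite ℂ (singularHomology ℂ ℂ (join a) (n + 1)) :=
  (finite_and_finrank_singularHomology_join n a ha).1

/-- **`dim_ℂ Hₙ₊₁(Ω_{a₀} * ⋯ * Ω_{aₙ₊₁}; ℂ) = Π_i (aᵢ − 1)`.** [cite: Milnor1968, §9 Thm. 9.1 and p. 77] -/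
theorem finrank_singularHomology_join {n : ℕ} {a : Fin (n + 2) → ℕ} (ha : ∀ i, a i ≠ 0) :
    Module.finrank ℂ (singularHomology ℂ ℂ (join a) (n + 1)) = ∏ i, (a i - 1) :=
  (finite_and_finrank_singularHomology_join n a ha).2

/-- `Hₙ₊₁` of the affine Milnor fibre `F = {Σ zᵢ^{aᵢ} = 1}` is finite-dimensional (`J ↪ F` is a homotopy
equivalence, Lemma 9.2). [cite: Milnor1968, §9 Thm. 9.1 and Lemma 9.2] -/
theorem finite_singularHomology_fibre {n : ℕ} {a : Fin (n + 2) → ℕ} (ha : ∀ i, a i ≠ 0) :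
    Module.Finite ℂ (singularHomology ℂ ℂ (fibre a) (n + 1)) := by
  haveI := finite_singularHomology_join ha
  exact Module.Finite.equiv
    (singularHomology.isoOfHomotopyEquiv ℂ ℂ (joinHomotopyEquivFibre a ha) (n + 1)).toLinearEquiv

/-- **Milnor's Theorem 9.1 (Betti number): `dim_ℂ Hₙ₊₁(F; ℂ) = Π_i (aᵢ − 1)`** for the affine Milnor fibre
`F = {z₀^{a₀} + ⋯ + zₙ₊₁^{aₙ₊₁} = 1} ⊂ ℂⁿ⁺²` (all `aᵢ ≠ 0`) — the Milnor number of the Pham–Brieskorn singularity.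
[cite: Milnor1968, §9 Thm. 9.1 and Lemma 9.2] [cite: Pham1965, §1] -/
theorem finrank_singularHomology_fibre {n : ℕ} {a : Fin (n + 2) → ℕ} (ha : ∀ i, a i ≠ 0) :
    Module.finrank ℂ (singularHomology ℂ ℂ (fibre a) (n + 1)) = ∏ i, (a i - 1) := by
  rw [← finrank_singularHomology_join ha]
  exact ((singularHomology.isoOfHomotopyEquiv ℂ ℂ (joinHomotopyEquivFibre a ha) (n + 1)).toLinearEquiv).symm.finrank_eq

end PhamBrieskorn

end Literature.Geometry.ComplexAnalytic

end
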